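import Summits.BirchSwinnertonDyer.Rank1Residual.Additive.X3RankZeroCyclotomicThree
import Summits.BirchSwinnertonDyer.Rank1Residual.Additive.X3RankZeroSemistableTwistAnyOdd
import Summits.BirchSwinnertonDyer.Rank1Residual.Additive.ChiBranchConstantTerm
import Summits.BirchSwinnertonDyer.Rank1Residual.Additive.ChiBranchConstantTermOdd
import HarnessLib

/-!
# Line V19, preparation: the MIDDLE branch `L_p(V, ω^{(p−1)/2}, 0)` against `L(W,1)/Ω_W` for the
# twist `W ≅ V^{(p*)}`, both parities at once (cell `b2b-bsdres`, seat additive-p4)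

HONEST FRAMING (cell `b2b-bsdres`, run/shared/lean/b2b/bsd-rank1-residual/, verbatim in every
file): the goal of the cell is to DELETE the COMBINATION-SHAPED residual classes of the
Birch–Swinnerton-Dyer formula for ALL analytic-rank `≤ 1` elliptic curves over `ℚ` — "full BSD
formula for every rank `≤ 1` curve in class `C`" assembled STRICTLY from published theorems — so
that the rank-`≤ 1` remainder becomes exactly the CONSTRUCTION-SHAPED classes, which are TYPED
(missing-input `Prop`s), NOT attempted. This is not "finishing BSD". Seat additive-p4 (research route
on X3/X4); no label moves; nothing is booked here.

Theorems only (no `def`, no `sorry`, no named fact). For `p ≡ 1 (mod 4)` the middle branch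
`i = (p−1)/2` of the Mazur–Swinnerton-Dyer measure is EVEN (`p* = p`): its constant term is
`α⁻¹·∑(a/p)[a/p]⁺_f` (`constantCoeff_padicLFunctionBranch_half`) and Birch + Pal give
`L(W,1)/Ω_W = ε·ϖ·∑(a/p)[a/p]⁺_f/|u(C)|` (`entireLFunction_one_eq_of_twist_explicit`); for
`p ≡ 3 (mod 4)` it is ODD (`p* = −p`): `α⁻¹·∑(a/p)[a/p]⁻_f` (`constantCoeff_padicLFunctionMinusBranch_half`)
and `L(W,1)/Ω_W = ε·ϖ'·∑(a/p)[a/p]⁻_f/(|u(C)|·c_∞)` (`entireLFunction_one_eq_of_twist_neg`). In both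
cases `ord_p u(C) = 0` (`padicValRat_u_eq_zero_of_twist_pm_p`). This file packages the two cases as
ONE existential datum `(ϖ_mid, S, t_W)` consumed by the core theorem of line V19
(`XGordRankZeroCyclotomicPrime.lean`): `B_mid(0) = α⁻¹S`, `L(W,1)/Ω_W = t_W ≠ 0`, `S ≠ 0`,
`ord_p t_W = ord_p ϖ_mid + ord_p S`, `ord_p ϖ_mid = ord_p ϖ` or `ord_p ϖ'` by parity.

References: Mazur–Tate–Teitelbaum 1986 §I.13–I.14; V. Pal, Canad. Math. Bull. 55 (2012) Thm. 3.2;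
B. J. Birch (twisted `L`-values by modular symbols), as in the tree files cited above.
-/

noncomputable section

open scoped Classical MatrixGroups ModularForm

open CongruenceSubgroup WeierstrassCurve NumberField IsDedekindDomain
  Literature.NumberTheory.EllipticCurves Literature.NumberTheory.EllipticCurves.ModularForms
  Literature.NumberTheory.EllipticCurves.Rank1Residual
  Literature.NumberTheory.GaloisRepresentations

namespace Summit.BirchSwinnertonDyer.Rank1Residual.Additive

section Prep

variable (p : ℕ) [hp : Fact p.Prime]
  (V : WeierstrassCurve ℚ) [V.IsElliptic] [V.IsGloballyMinimal]
  (W : WeierstrassCurve ℚ) [W.IsElliptic] [W.IsGloballyMinimal]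

/-- **The middle-branch datum of line V19 (both parities).** For `p` odd, `V/ℚ` globally minimal
good ordinary at `p` with newform `f`, `W = C • V^{(p*)}` globally minimal and additive at `p`,
`ϖ·Ω_V = Ω⁺_f`, `ϖ'·|Ω⁻(V)| = Ω⁻_f`, `ϖ ≠ 0`, `L(W,1) ≠ 0`, `α = unitRoot V p`: there are
rationals `ϖ_mid, S, t_W` with `B_{(p−1)/2}(0) = α⁻¹·S` (`B_i` the `ω^i`-branch, even/odd by the
parity of `i = (p−1)/2`), `L(W,1)/Ω_W = t_W`, `t_W ≠ 0`, `S ≠ 0`, `ord_p t_W = ord_p ϖ_mid + ord_p S`,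
and `ord_p ϖ_mid = ord_p ϖ` (`p ≡ 1 (mod 4)`) resp. `ord_p ϖ'` (`p ≡ 3 (mod 4)`): Birch + Pal for the
twist by `p* = ±p` (`entireLFunction_one_eq_of_twist_explicit` / `…_of_twist_neg`), the middle
constant terms (`constantCoeff_padicLFunctionBranch_half` / `…MinusBranch_half`), `ord_p u(C) = 0`.
[cite: MazurTateTeitelbaum1986Invent, §I.13–I.14] [cite: Pal2012, Thm. 3.2] -/
theorem XGordCyclotomicPrime.exists_midBranch_datum (hmod : hasEntireLFunction_rat) (hp2 : p ≠ 2)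
    (C : VariableChange ℚ) (hC : C • V.quadraticTwist ((-1 : ℚ) ^ (p / 2) * p) = W)
    (hord : IsOrdinaryAt V p) (hadd : Addv W p)
    {N : ℕ} [NeZero N] {f : CuspForm (Gamma0 N) 2} (hf : IsNewformOf V f)
    (ϖ ϖ' : ℚ) (hϖ : (ϖ : ℝ) * V.realPeriodRat = plusPeriod f)
    (hϖ' : (ϖ' : ℝ) * V.imaginaryPeriodRat = minusPeriod f) (hϖ0 : ϖ ≠ 0)
    (hLW : W.entireLFunction 1 ≠ 0) :
    ∃ ϖm S tW : ℚ,
      PowerSeries.constantCoeff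
          (if Even (p / 2) then padicLFunctionBranch f ((unitRoot V p : ℤ_[p]) : ℚ_[p]) (p / 2)
            else padicLFunctionMinusBranch f ((unitRoot V p : ℤ_[p]) : ℚ_[p]) (p / 2)) =
        (((unitRoot V p : ℤ_[p]) : ℚ_[p]))⁻¹ * ((S : ℚ) : ℚ_[p]) ∧
      W.entireLFunction 1 / (W.realPeriodRat : ℂ) = ((tW : ℚ) : ℂ) ∧ tW ≠ 0 ∧ S ≠ 0 ∧
      padicValRat p tW = padicValRat p ϖm + padicValRat p S ∧
      padicValRat p ϖm = (if p % 4 = 1 then padicValRat p ϖ else padicValRat p ϖ') := by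
  classical
  haveI : NeZero p := ⟨hp.out.ne_zero⟩
  have hodd : p % 4 = 1 ∨ p % 4 = 3 := by
    obtain ⟨k, hk⟩ := hp.out.odd_of_ne_two hp2
    omega
  set a : ℚ_[p] := ((unitRoot V p : ℤ_[p]) : ℚ_[p]) with ha
  set B : ℕ → PowerSeries ℚ_[p] := fun i ↦
    (if Even i then padicLFunctionBranch f a i else padicLFunctionMinusBranch f a i) with hB
  show ∃ ϖm S tW : ℚ, PowerSeries.constantCoeff (B (p / 2)) = a⁻¹ * ((S : ℚ) : ℚ_[p]) ∧ _
  -- `ord_p u(C) = 0`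
  have hvuC : padicValRat p |(C.u : ℚ)| = 0 := by
    have hu0 : padicValRat p (C.u : ℚ) = 0 := by
      rcases hodd with h1 | h3
      · have hC3 : C • V.quadraticTwist ((((p : ℕ) : ℤ)) : ℚ) = W := by
          rw [pStar_eq_of_mod_four p (Or.inl h1), if_pos h1] at hC
          push_cast; exact hC
        exact padicValRat_u_eq_zero_of_twist_pm_p p hp2 V W (Or.inl hord.1) (Or.inl rfl) C hC3
      · have hC3 : C • V.quadraticTwist (((-((p : ℕ) : ℤ)) : ℤ) : ℚ) = W := by
          rw [pStar_eq_of_mod_four p (Or.inr h3), if_neg (by omega)] at hC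
          push_cast; exact hC
        exact padicValRat_u_eq_zero_of_twist_pm_p p hp2 V W (Or.inl hord.1) (Or.inr rfl) C hC3
    rcases abs_choice (C.u : ℚ) with h' | h'
    · rw [h', hu0]
    · rw [h', padicValRat.neg, hu0]
  have hua0 : |(C.u : ℚ)| ≠ 0 := abs_ne_zero.mpr C.u.ne_zero
  -- the analytic side over `ℚ` for `W` and the middle branch, by parity
  have hΩW : (W.realPeriodRat : ℂ) ≠ 0 := by exact_mod_cast W.realPeriodRat_pos_holds.ne'
  obtain ⟨ϖm, S, tW, hBmid, hqW', htW0, hS0, hvtW, hvϖm⟩ : ∃ ϖm S tW : ℚ,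
      PowerSeries.constantCoeff (B (p / 2)) = a⁻¹ * ((S : ℚ) : ℚ_[p]) ∧
      W.entireLFunction 1 / (W.realPeriodRat : ℂ) = ((tW : ℚ) : ℂ) ∧ tW ≠ 0 ∧ S ≠ 0 ∧
      padicValRat p tW = padicValRat p ϖm + padicValRat p S ∧
      padicValRat p ϖm = (if p % 4 = 1 then padicValRat p ϖ else padicValRat p ϖ') := by
    rcases hodd with h1 | h3
    · -- `p ≡ 1 (mod 4)`: even middle branch, Birch + Pal with `Ω⁺`
      have heven : Even (p / 2) := by rw [Nat.even_iff]; omega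
      have hC' : C • V.quadraticTwist (p : ℚ) = W := by
        rw [pStar_eq_of_mod_four p (Or.inl h1), if_pos h1] at hC
        exact hC
      obtain ⟨ε, hε, hLW_eq⟩ :=
        entireLFunction_one_eq_of_twist_explicit p hmod h1 V W C hC' hadd hf ϖ hϖ
      have hε0 : ε ≠ 0 := by rcases hε with h | h <;> rw [h] <;> norm_num
      have hvε : padicValRat p ε = 0 := by
        rcases hε with h | h
        · rw [h, padicValRat.one]
        · rw [h, padicValRat.neg, padicValRat.one]
      have hnum0 : ε * (ϖ * legendrePlusSymbolSum f p) ≠ 0 := by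
        intro h0
        apply hLW
        rw [hLW_eq, h0, zero_div, Rat.cast_zero, zero_mul]
      have hϖS : ϖ * legendrePlusSymbolSum f p ≠ 0 := fun h0 ↦ hnum0 (by rw [h0, mul_zero])
      have hS0 : legendrePlusSymbolSum f p ≠ 0 := fun h0 ↦ hϖS (by rw [h0, mul_zero])
      refine ⟨ϖ, legendrePlusSymbolSum f p, ε * (ϖ * legendrePlusSymbolSum f p) / |(C.u : ℚ)|,
        ?_, ?_, div_ne_zero hnum0 hua0, hS0, ?_, by rw [if_pos h1]⟩
      · have hb : B (p / 2) = padicLFunctionBranch f a (p / 2) := by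
          simp only [hB, if_pos heven]
        rw [hb, ha]
        exact constantCoeff_padicLFunctionBranch_half p hp2 V hord hf
      · rw [hLW_eq, mul_div_cancel_right₀ _ hΩW]
      · rw [padicValRat.div hnum0 hua0, padicValRat.mul hε0 hϖS, padicValRat.mul hϖ0 hS0, hvε, hvuC]
        ring
    · -- `p ≡ 3 (mod 4)`: odd middle branch, odd Birch + Pal with `|Ω⁻|`
      have hoddm : ¬ Even (p / 2) := by rw [Nat.not_even_iff]; omega
      have hC' : C • V.quadraticTwist (-(p : ℚ)) = W := by
        rw [pStar_eq_of_mod_four p (Or.inr h3), if_neg (by omega)] at hC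
        exact hC
      obtain ⟨ε, hε, hLW_eq⟩ :=
        entireLFunction_one_eq_of_twist_neg p hmod h3 V W C hC' hadd hf ϖ' hϖ'
      set cinf : ℕ := (W.baseChange ℝ).numRealComponents with hcinf
      have hε0 : ε ≠ 0 := by rcases hε with h | h <;> rw [h] <;> norm_num
      have hvε : padicValRat p ε = 0 := by
        rcases hε with h | h
        · rw [h, padicValRat.one]
        · rw [h, padicValRat.neg, padicValRat.one]
      have hcinf0 : (cinf : ℚ) ≠ 0 := by
        rw [hcinf, numRealComponents]
        split_ifs <;> norm_num
      have hden0 : |(C.u : ℚ)| * (cinf : ℚ) ≠ 0 := mul_ne_zero hua0 hcinf0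
      have hnum0 : ε * (ϖ' * legendreMinusSymbolSum f p) ≠ 0 := by
        intro h0
        apply hLW
        rw [hLW_eq, h0, zero_div, Rat.cast_zero, zero_mul]
      have hϖS : ϖ' * legendreMinusSymbolSum f p ≠ 0 := fun h0 ↦ hnum0 (by rw [h0, mul_zero])
      have hϖ'0 : ϖ' ≠ 0 := fun h0 ↦ hϖS (by rw [h0, zero_mul])
      have hS0 : legendreMinusSymbolSum f p ≠ 0 := fun h0 ↦ hϖS (by rw [h0, mul_zero])
      refine ⟨ϖ', legendreMinusSymbolSum f p,
        ε * (ϖ' * legendreMinusSymbolSum f p) / (|(C.u : ℚ)| * (cinf : ℚ)), ?_, ?_,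
        div_ne_zero hnum0 hden0, hS0, ?_, by rw [if_neg (by omega)]⟩
      · have hb : B (p / 2) = padicLFunctionMinusBranch f a (p / 2) := by
          simp only [hB, if_neg hoddm]
        rw [hb, ha]
        exact constantCoeff_padicLFunctionMinusBranch_half p hp2 V hord hf
      · rw [hLW_eq, mul_div_cancel_right₀ _ hΩW]
      · rw [padicValRat.div hnum0 hden0, padicValRat.mul hε0 hϖS, padicValRat.mul hϖ'0 hS0, hvε,
          padicValRat.mul hua0 hcinf0, hvuC, hcinf, padicValRat_numRealComponents_eq_zero W p hp2]
        ring
  exact ⟨ϖm, S, tW, hBmid, hqW', htW0, hS0, hvtW, hvϖm⟩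

end Prep

end Summit.BirchSwinnertonDyer.Rank1Residual.Additive

end
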